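import Mathlib
import HarnessLib
import Summits.HubbardSuperconductivity.HubbardSuperconductivity.Theorems.KLProgrammeThinLevelSetVolume
import Summits.HubbardSuperconductivity.HubbardSuperconductivity.Theorems.KLProgrammeThinLevelSetRadialGrowth
import Summits.HubbardSuperconductivity.HubbardSuperconductivity.Theorems.KLProgrammeThinLevelSetTripleSum

/-!
# Route `KLProgramme` — K3 engine (stmt-HubbardSuperconductivity-20437), stub (b) (ℓ)/(I2)–(I3), located item «ABS-UMK-COUNT» / «UV-REMEASURE-COUNT»:
# lattice points in thin level sets, part 5 — LOCAL versions (derivative hypotheses on the relevant intervals only)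

Cell gate-hubbard-kl, seat p4 g14 (pen (R133)(ii)).  Parts 3 and 4 (`…ThinLevelSetRadialGrowth`, `…ThinLevelSetTripleSum`) take GLOBAL differentiability of the
one-variable functions; the graph function `f` of a frame's Fermi curve over its tangent line at a corner direction is defined and `C²` only on a bounded
interval.  This file restates them with derivative hypotheses ON THE INTERVALS ACTUALLY VISITED:

* `sub_ge_of_deriv2_ge_on`, `sub_le_of_deriv2_le_on` (and the `deriv_…_on` lemmas) — `g, g′` differentiable at the points of `[0, 1]` only;
* `radialGrowth_of_segment_on`, `radialUpper_of_segment_on` — along the segment for `s ∈ [0, 1]` only;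
* `card_mul_sq_le_tripleSum_local` — `f` measurable, differentiable (twice) at the points of `[τ/3 − 2ρ′, τ/3 + 2ρ′]` only, same conclusion
  `#P · h² ≤ 960·A·(2δ + (4B+1)h)/c²`.

Everything is PROVED; no definitions, no named facts; generic calculus. [folklore]
-/

noncomputable section

open Real Set MeasureTheory Metric

namespace Summit.HubbardSuperconductivity.HubbardSuperconductivity.Theorems.ThinLevelSet

set_option linter.dupNamespace false -- summit = problem name (single-conjunct summit), D-0017

/-! ## §1 One-variable growth, local hypotheses -/

/-- If `g′(0) ≥ 0` and `g″ ≥ κ` on `[0, 1]` (derivatives at the points of `[0,1]`), then `g′ s ≥ κ s` on `[0, 1]`. [folklore] -/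
theorem deriv_ge_mul_of_deriv2_ge_on {g' g'' : ℝ → ℝ} (hg' : ∀ s ∈ Icc (0 : ℝ) 1, HasDerivAt g' (g'' s) s) {κ : ℝ}
    (hκ : ∀ s ∈ Icc (0 : ℝ) 1, κ ≤ g'' s) (h0 : 0 ≤ g' 0) {s : ℝ} (hs : s ∈ Icc (0 : ℝ) 1) : κ * s ≤ g' s := by
  have hd : ∀ u ∈ Icc (0 : ℝ) 1, HasDerivAt (fun u => g' u - κ * u) (g'' u - κ * 1) u :=
    fun u hu => (hg' u hu).sub ((hasDerivAt_id u).const_mul κ)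
  have hmono : MonotoneOn (fun u => g' u - κ * u) (Icc (0 : ℝ) 1) := by
    apply monotoneOn_of_deriv_nonneg (convex_Icc 0 1)
    · exact fun u hu => (hd u hu).continuousAt.continuousWithinAt
    · intro u hu
      rw [interior_Icc] at hu
      exact (hd u (Ioo_subset_Icc_self hu)).differentiableAt.differentiableWithinAt
    · intro u hu
      rw [interior_Icc] at hu
      rw [(hd u (Ioo_subset_Icc_self hu)).deriv]
      have := hκ u (Ioo_subset_Icc_self hu)
      linarith
  have h := hmono (left_mem_Icc.2 zero_le_one) hs hs.1
  simp only [mul_zero, sub_zero] at h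
  linarith

/-- If `g′(0) ≥ 0` and `g″ ≥ κ` on `[0, 1]` (derivatives at the points of `[0,1]`), then `g 1 − g t ≥ (κ/2)(1 − t²)` for `t ∈ [0, 1]`. [folklore] -/
theorem sub_ge_of_deriv2_ge_on {g g' g'' : ℝ → ℝ} (hg : ∀ s ∈ Icc (0 : ℝ) 1, HasDerivAt g (g' s) s)
    (hg' : ∀ s ∈ Icc (0 : ℝ) 1, HasDerivAt g' (g'' s) s) {κ : ℝ}
    (hκ : ∀ s ∈ Icc (0 : ℝ) 1, κ ≤ g'' s) (h0 : 0 ≤ g' 0) {t : ℝ} (ht : t ∈ Icc (0 : ℝ) 1) :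
    κ / 2 * (1 - t ^ 2) ≤ g 1 - g t := by
  have hd : ∀ u ∈ Icc (0 : ℝ) 1, HasDerivAt (fun u => g u - κ / 2 * u ^ 2) (g' u - κ / 2 * (2 * u)) u := by
    intro u hu
    have h1 : HasDerivAt (fun u : ℝ => u ^ 2) (2 * u) u := by
      simpa using hasDerivAt_pow 2 u
    exact (hg u hu).sub (h1.const_mul (κ / 2))
  have hmono : MonotoneOn (fun u => g u - κ / 2 * u ^ 2) (Icc (0 : ℝ) 1) := by
    apply monotoneOn_of_deriv_nonneg (convex_Icc 0 1)
    · exact fun u hu => (hd u hu).continuousAt.continuousWithinAt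
    · intro u hu
      rw [interior_Icc] at hu
      exact (hd u (Ioo_subset_Icc_self hu)).differentiableAt.differentiableWithinAt
    · intro u hu
      rw [interior_Icc] at hu
      rw [(hd u (Ioo_subset_Icc_self hu)).deriv]
      have := deriv_ge_mul_of_deriv2_ge_on hg' hκ h0 (Ioo_subset_Icc_self hu)
      linarith
  have h := hmono ht (right_mem_Icc.2 zero_le_one) ht.2
  simp only [one_pow, mul_one] at h
  linarith

/-- If `g′(0) ≤ 0` and `g″ ≤ K` on `[0, 1]` (derivatives at the points of `[0,1]`), then `g 1 − g t ≤ (K/2)(1 − t²)` for `t ∈ [0, 1]`. [folklore] -/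
theorem sub_le_of_deriv2_le_on {g g' g'' : ℝ → ℝ} (hg : ∀ s ∈ Icc (0 : ℝ) 1, HasDerivAt g (g' s) s)
    (hg' : ∀ s ∈ Icc (0 : ℝ) 1, HasDerivAt g' (g'' s) s) {K : ℝ}
    (hK : ∀ s ∈ Icc (0 : ℝ) 1, g'' s ≤ K) (h0 : g' 0 ≤ 0) {t : ℝ} (ht : t ∈ Icc (0 : ℝ) 1) :
    g 1 - g t ≤ K / 2 * (1 - t ^ 2) := by
  have h := sub_ge_of_deriv2_ge_on (g := fun u => -g u) (g' := fun u => -g' u) (g'' := fun u => -g'' u) (κ := -K)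
    (fun u hu => (hg u hu).neg) (fun u hu => (hg' u hu).neg) (fun u hu => by linarith [hK u hu]) (by linarith) ht
  linarith

/-! ## §2 Radial hypotheses along a segment, local -/

/-- **Radial strong growth, local hypotheses** (as `radialGrowth_of_segment`, derivatives for `s ∈ [0,1]` only). [folklore] -/
theorem radialGrowth_of_segment_on {E : Type*} [NormedAddCommGroup E] [NormedSpace ℝ E] {F : E → ℝ} {xs x : E} {g' g'' : ℝ → ℝ} {c : ℝ}
    (hg : ∀ s ∈ Icc (0 : ℝ) 1, HasDerivAt (fun s : ℝ => F (AffineMap.homothety xs s x)) (g' s) s)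
    (hg' : ∀ s ∈ Icc (0 : ℝ) 1, HasDerivAt g' (g'' s) s)
    (h0 : 0 ≤ g' 0) (hfloor : ∀ s ∈ Icc (0 : ℝ) 1, c * ‖x - xs‖ ^ 2 ≤ g'' s) {t : ℝ} (ht0 : 0 ≤ t) (ht1 : t ≤ 1) :
    F (AffineMap.homothety xs t x) ≤ F x - c / 2 * (1 - t ^ 2) * ‖x - xs‖ ^ 2 := by
  have h := sub_ge_of_deriv2_ge_on hg hg' hfloor h0 ⟨ht0, ht1⟩
  have e : AffineMap.homothety xs (1 : ℝ) x = x := by rw [homothety_eq_add_smul, one_smul, add_sub_cancel]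
  simp only [e] at h
  nlinarith [h]

/-- **Radial quadratic upper bound, local hypotheses** (as `radialUpper_of_segment`). [folklore] -/
theorem radialUpper_of_segment_on {E : Type*} [NormedAddCommGroup E] [NormedSpace ℝ E] {F : E → ℝ} {xs x : E} {g' g'' : ℝ → ℝ} {A : ℝ}
    (hg : ∀ s ∈ Icc (0 : ℝ) 1, HasDerivAt (fun s : ℝ => F (AffineMap.homothety xs s x)) (g' s) s)
    (hg' : ∀ s ∈ Icc (0 : ℝ) 1, HasDerivAt g' (g'' s) s)
    (h0 : g' 0 ≤ 0) (hceil : ∀ s ∈ Icc (0 : ℝ) 1, g'' s ≤ A * ‖x - xs‖ ^ 2) :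
    F x - F xs ≤ A / 2 * ‖x - xs‖ ^ 2 := by
  have h := sub_le_of_deriv2_le_on hg hg' hceil h0 (left_mem_Icc.2 zero_le_one)
  have e1 : AffineMap.homothety xs (1 : ℝ) x = x := by rw [homothety_eq_add_smul, one_smul, add_sub_cancel]
  have e0 : AffineMap.homothety xs (0 : ℝ) x = xs := by rw [homothety_eq_add_smul, zero_smul, add_zero]
  simp only [e1, e0] at h
  nlinarith [h]

/-! ## §3 The triple-sum pair count with local hypotheses on `f` -/

/-- First derivative of the line function of the triple sum at a point whose three arguments lie in the interval `I` where `f` is differentiable. [folklore] -/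
theorem hasDerivAt_tripleSum_line_of_mem {f f' : ℝ → ℝ} {I : Set ℝ} (hf : ∀ u ∈ I, HasDerivAt f (f' u) u) (τ p₀ p₁ v₀ v₁ s : ℝ)
    (h₀I : p₀ + s * v₀ ∈ I) (h₁I : p₁ + s * v₁ ∈ I) (h₂I : τ - (p₀ + s * v₀) - (p₁ + s * v₁) ∈ I) :
    HasDerivAt (fun s : ℝ => f (p₀ + s * v₀) + f (p₁ + s * v₁) + f (τ - (p₀ + s * v₀) - (p₁ + s * v₁)))
      (f' (p₀ + s * v₀) * v₀ + f' (p₁ + s * v₁) * v₁ + f' (τ - (p₀ + s * v₀) - (p₁ + s * v₁)) * (0 - v₀ - v₁)) s := by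
  have h₀ : HasDerivAt (fun s : ℝ => p₀ + s * v₀) v₀ s := by
    simpa using ((hasDerivAt_id s).mul_const v₀).const_add p₀
  have h₁ : HasDerivAt (fun s : ℝ => p₁ + s * v₁) v₁ s := by
    simpa using ((hasDerivAt_id s).mul_const v₁).const_add p₁
  have h₂ : HasDerivAt (fun s : ℝ => τ - (p₀ + s * v₀) - (p₁ + s * v₁)) (0 - v₀ - v₁) s :=
    ((hasDerivAt_const s τ).sub h₀).sub h₁
  exact (((hf _ h₀I).comp s h₀).add ((hf _ h₁I).comp s h₁)).add ((hf _ h₂I).comp s h₂)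

/-- Second derivative of the line function of the triple sum, local version. [folklore] -/
theorem hasDerivAt_tripleSum_line_deriv_of_mem {f' f'' : ℝ → ℝ} {I : Set ℝ} (hf' : ∀ u ∈ I, HasDerivAt f' (f'' u) u) (τ p₀ p₁ v₀ v₁ s : ℝ)
    (h₀I : p₀ + s * v₀ ∈ I) (h₁I : p₁ + s * v₁ ∈ I) (h₂I : τ - (p₀ + s * v₀) - (p₁ + s * v₁) ∈ I) :
    HasDerivAt (fun s : ℝ => f' (p₀ + s * v₀) * v₀ + f' (p₁ + s * v₁) * v₁ + f' (τ - (p₀ + s * v₀) - (p₁ + s * v₁)) * (0 - v₀ - v₁))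
      (f'' (p₀ + s * v₀) * v₀ * v₀ + f'' (p₁ + s * v₁) * v₁ * v₁ +
        f'' (τ - (p₀ + s * v₀) - (p₁ + s * v₁)) * (0 - v₀ - v₁) * (0 - v₀ - v₁)) s := by
  have h₀ : HasDerivAt (fun s : ℝ => p₀ + s * v₀) v₀ s := by
    simpa using ((hasDerivAt_id s).mul_const v₀).const_add p₀
  have h₁ : HasDerivAt (fun s : ℝ => p₁ + s * v₁) v₁ s := by
    simpa using ((hasDerivAt_id s).mul_const v₁).const_add p₁
  have h₂ : HasDerivAt (fun s : ℝ => τ - (p₀ + s * v₀) - (p₁ + s * v₁)) (0 - v₀ - v₁) s :=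
    ((hasDerivAt_const s τ).sub h₀).sub h₁
  exact ((((hf' _ h₀I).comp s h₀).mul_const v₀).add (((hf' _ h₁I).comp s h₁).mul_const v₁)).add (((hf' _ h₂I).comp s h₂).mul_const _)

set_option maxHeartbeats 400000 in -- many hypothesis dischargers for the part-2 theorem in one proof; 200k is marginal
/-- **The pair count for the symmetric triple sum, LOCAL hypotheses.**  As `card_mul_sq_le_tripleSum`, but `f` is only assumed measurable and twice
differentiable AT THE POINTS of `I = [τ/3 − 2ρ′, τ/3 + 2ρ′]` (with `c ≤ f″ ≤ A`, `|f′| ≤ B` there): an `h`-separated finite set of points of the sup-ball of radius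
`ρ` about `(τ/3, τ/3)` (`ρ + h/2 ≤ ρ′`) inside the window `|f(p₀) + f(p₁) + f(τ − p₀ − p₁) − β| ≤ δ` has `#P · h² ≤ 960·A·(2δ + (4B + 1)h)/c²`. [folklore] -/
theorem card_mul_sq_le_tripleSum_local {f f' f'' : ℝ → ℝ} (hfm : Measurable f) {τ ρ ρ' c A B h δ β : ℝ}
    (hf : ∀ u ∈ Icc (τ / 3 - 2 * ρ') (τ / 3 + 2 * ρ'), HasDerivAt f (f' u) u)
    (hf' : ∀ u ∈ Icc (τ / 3 - 2 * ρ') (τ / 3 + 2 * ρ'), HasDerivAt f' (f'' u) u)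
    (hρ : 0 ≤ ρ) (hh : 0 < h) (hρ' : ρ + h / 2 ≤ ρ') (hc : 0 < c) (hcA : c ≤ A) (hB : 0 ≤ B) (hδ : 0 ≤ δ)
    (hfloor : ∀ u ∈ Icc (τ / 3 - 2 * ρ') (τ / 3 + 2 * ρ'), c ≤ f'' u)
    (hceil : ∀ u ∈ Icc (τ / 3 - 2 * ρ') (τ / 3 + 2 * ρ'), f'' u ≤ A)
    (hder : ∀ u ∈ Icc (τ / 3 - 2 * ρ') (τ / 3 + 2 * ρ'), |f' u| ≤ B)
    (P : Finset (Fin 2 → ℝ)) (hsep : ∀ p ∈ P, ∀ q ∈ P, p ≠ q → h ≤ dist p q)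
    (hP : ∀ p ∈ P, p ∈ Metric.closedBall (fun _ : Fin 2 => τ / 3) ρ ∧ |f (p 0) + f (p 1) + f (τ - p 0 - p 1) - β| ≤ δ) :
    (P.card : ℝ) * h ^ 2 ≤ 960 * A * (2 * δ + (4 * B + 1) * h) / c ^ 2 := by
  have hA : 0 < A := hc.trans_le hcA
  have hρ'0 : 0 < ρ' := by linarith
  set xs : Fin 2 → ℝ := fun _ => τ / 3 with hxs
  set D : Set (Fin 2 → ℝ) := Metric.closedBall xs ρ with hD
  set D' : Set (Fin 2 → ℝ) := Metric.closedBall xs ρ' with hD'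
  set F : (Fin 2 → ℝ) → ℝ := fun p => f (p 0) + f (p 1) + f (τ - p 0 - p 1) with hFdef
  set I : Set ℝ := Icc (τ / 3 - 2 * ρ') (τ / 3 + 2 * ρ') with hI
  -- points of `D′`: coordinates (and the third argument) in `I`
  have hcoord : ∀ p ∈ D', p 0 ∈ I ∧ p 1 ∈ I ∧ τ - p 0 - p 1 ∈ I := by
    intro p hp
    have h0 := abs_le.1 (abs_sub_le_of_mem_closedBall_diag hp 0)
    have h1 := abs_le.1 (abs_sub_le_of_mem_closedBall_diag hp 1)
    refine ⟨⟨by linarith, by linarith⟩, ⟨by linarith, by linarith⟩, ⟨by linarith, by linarith⟩⟩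
  -- the segment `y + s (x − y)` stays in the convex set `D′`
  have hD'c : Convex ℝ D' := convex_closedBall _ _
  have hseg : ∀ x ∈ D', ∀ y ∈ D', ∀ s ∈ Icc (0 : ℝ) 1, y + s • (x - y) ∈ D' := by
    intro x hx y hy s hs
    have := hD'c hy hx (by linarith [hs.2] : (0 : ℝ) ≤ 1 - s) hs.1 (by ring)
    have e : (1 - s) • y + s • x = y + s • (x - y) := by
      rw [smul_sub, sub_smul, one_smul]; abel
    rw [e] at this; exact this
  -- the function along a line, in coordinates
  have hline : ∀ (y v : Fin 2 → ℝ) (s : ℝ), F (y + s • v) =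
      f (y 0 + s * v 0) + f (y 1 + s * v 1) + f (τ - (y 0 + s * v 0) - (y 1 + s * v 1)) := by
    intro y v s
    simp only [hFdef, Pi.add_apply, Pi.smul_apply, smul_eq_mul]
  -- the three arguments along a segment in `D′` are in `I`
  have hargs : ∀ x ∈ D', ∀ y ∈ D', ∀ s ∈ Icc (0 : ℝ) 1,
      y 0 + s * (x - y) 0 ∈ I ∧ y 1 + s * (x - y) 1 ∈ I ∧ τ - (y 0 + s * (x - y) 0) - (y 1 + s * (x - y) 1) ∈ I := by
    intro x hx y hy s hs
    have hmem : y + s • (x - y) ∈ D' := hseg x hx y hy s hs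
    obtain ⟨hc0, hc1, hc2⟩ := hcoord _ hmem
    simp only [Pi.add_apply, Pi.smul_apply, smul_eq_mul] at hc0 hc1 hc2
    exact ⟨hc0, hc1, hc2⟩
  -- Lipschitz on `D′` with constant `4B`
  have hLip : ∀ x ∈ D', ∀ y ∈ D', |F x - F y| ≤ 4 * B * dist x y := by
    intro x hx y hy
    set v := x - y with hv
    set φ : ℝ → ℝ := fun s => f (y 0 + s * v 0) + f (y 1 + s * v 1) + f (τ - (y 0 + s * v 0) - (y 1 + s * v 1)) with hφ
    have hφd : ∀ s ∈ Icc (0 : ℝ) 1, HasDerivAt φ (f' (y 0 + s * v 0) * v 0 + f' (y 1 + s * v 1) * v 1 +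
        f' (τ - (y 0 + s * v 0) - (y 1 + s * v 1)) * (0 - v 0 - v 1)) s := by
      intro s hs
      obtain ⟨h0I, h1I, h2I⟩ := hargs x hx y hy s hs
      exact hasDerivAt_tripleSum_line_of_mem hf τ (y 0) (y 1) (v 0) (v 1) s h0I h1I h2I
    have hbound : ∀ s ∈ Ico (0 : ℝ) 1, ‖f' (y 0 + s * v 0) * v 0 + f' (y 1 + s * v 1) * v 1 +
        f' (τ - (y 0 + s * v 0) - (y 1 + s * v 1)) * (0 - v 0 - v 1)‖ ≤ 4 * B * ‖v‖ := by
      intro s hs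
      obtain ⟨hc0, hc1, hc2⟩ := hargs x hx y hy s (Ico_subset_Icc_self hs)
      have hb0 := hder _ hc0
      have hb1 := hder _ hc1
      have hb2 := hder _ hc2
      have hv0 : |v 0| ≤ ‖v‖ := by have := norm_le_pi_norm v 0; rwa [Real.norm_eq_abs] at this
      have hv1 : |v 1| ≤ ‖v‖ := by have := norm_le_pi_norm v 1; rwa [Real.norm_eq_abs] at this
      rw [Real.norm_eq_abs]
      calc |f' (y 0 + s * v 0) * v 0 + f' (y 1 + s * v 1) * v 1 + f' (τ - (y 0 + s * v 0) - (y 1 + s * v 1)) * (0 - v 0 - v 1)|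
          ≤ |f' (y 0 + s * v 0) * v 0| + |f' (y 1 + s * v 1) * v 1| + |f' (τ - (y 0 + s * v 0) - (y 1 + s * v 1)) * (0 - v 0 - v 1)| :=
            abs_add_three _ _ _
        _ = |f' (y 0 + s * v 0)| * |v 0| + |f' (y 1 + s * v 1)| * |v 1| + |f' (τ - (y 0 + s * v 0) - (y 1 + s * v 1))| * |0 - v 0 - v 1| := by
            rw [abs_mul, abs_mul, abs_mul]
        _ ≤ B * ‖v‖ + B * ‖v‖ + B * (‖v‖ + ‖v‖) := by
            have h3 : |0 - v 0 - v 1| ≤ ‖v‖ + ‖v‖ := by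
              calc |0 - v 0 - v 1| = |v 0 + v 1| := by rw [show (0 : ℝ) - v 0 - v 1 = -(v 0 + v 1) by ring, abs_neg]
                _ ≤ |v 0| + |v 1| := abs_add_le _ _
                _ ≤ ‖v‖ + ‖v‖ := add_le_add hv0 hv1
            gcongr
        _ = 4 * B * ‖v‖ := by ring
    have hmv := norm_image_sub_le_of_norm_deriv_le_segment_01' (fun s hs => (hφd s hs).hasDerivWithinAt) hbound
    have e1 : φ 1 = F x := by
      have h1 := hline y v 1
      have hx' : y + (1 : ℝ) • v = x := by rw [hv, one_smul]; abel
      rw [hx'] at h1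
      simp only [hφ]
      rw [h1]
    have e0 : φ 0 = F y := by
      simp only [hφ, hFdef, zero_mul, add_zero]
    rw [e1, e0, Real.norm_eq_abs] at hmv
    rwa [dist_eq_norm]
  -- radial growth and radial upper bound about `xs` on `D′`
  have hxsD' : xs ∈ D' := mem_closedBall_self hρ'0.le
  have hτI : τ / 3 ∈ I := ⟨by linarith, by linarith⟩
  have hgrow : ∀ x ∈ D', ∀ t : ℝ, 0 ≤ t → t ≤ 1 →
      F (AffineMap.homothety xs t x) ≤ F x - c / 2 * (1 - t ^ 2) * ‖x - xs‖ ^ 2 := by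
    intro x hx t ht0 ht1
    set v := x - xs with hv
    have hfun : (fun s : ℝ => F (AffineMap.homothety xs s x)) =
        fun s => f (τ / 3 + s * v 0) + f (τ / 3 + s * v 1) + f (τ - (τ / 3 + s * v 0) - (τ / 3 + s * v 1)) := by
      funext s
      rw [homothety_eq_add_smul, hline]
    have hargs' : ∀ s ∈ Icc (0 : ℝ) 1, τ / 3 + s * v 0 ∈ I ∧ τ / 3 + s * v 1 ∈ I ∧ τ - (τ / 3 + s * v 0) - (τ / 3 + s * v 1) ∈ I := by
      intro s hs
      have := hargs x hx xs hxsD' s hs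
      simpa [hv, hxs] using this
    have hg : ∀ s ∈ Icc (0 : ℝ) 1, HasDerivAt (fun s : ℝ => F (AffineMap.homothety xs s x))
        (f' (τ / 3 + s * v 0) * v 0 + f' (τ / 3 + s * v 1) * v 1 + f' (τ - (τ / 3 + s * v 0) - (τ / 3 + s * v 1)) * (0 - v 0 - v 1)) s := by
      intro s hs; rw [hfun]
      obtain ⟨h0I, h1I, h2I⟩ := hargs' s hs
      exact hasDerivAt_tripleSum_line_of_mem hf τ (τ / 3) (τ / 3) (v 0) (v 1) s h0I h1I h2I
    have hg' : ∀ s ∈ Icc (0 : ℝ) 1, HasDerivAt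
        (fun s : ℝ => f' (τ / 3 + s * v 0) * v 0 + f' (τ / 3 + s * v 1) * v 1 + f' (τ - (τ / 3 + s * v 0) - (τ / 3 + s * v 1)) * (0 - v 0 - v 1))
        (f'' (τ / 3 + s * v 0) * v 0 * v 0 + f'' (τ / 3 + s * v 1) * v 1 * v 1 +
          f'' (τ - (τ / 3 + s * v 0) - (τ / 3 + s * v 1)) * (0 - v 0 - v 1) * (0 - v 0 - v 1)) s := by
      intro s hs
      obtain ⟨h0I, h1I, h2I⟩ := hargs' s hs
      exact hasDerivAt_tripleSum_line_deriv_of_mem hf' τ (τ / 3) (τ / 3) (v 0) (v 1) s h0I h1I h2I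
    have h0 : (0 : ℝ) ≤ f' (τ / 3 + 0 * v 0) * v 0 + f' (τ / 3 + 0 * v 1) * v 1 +
        f' (τ - (τ / 3 + 0 * v 0) - (τ / 3 + 0 * v 1)) * (0 - v 0 - v 1) := by
      have e : τ - (τ / 3 + 0 * v 0) - (τ / 3 + 0 * v 1) = τ / 3 := by ring
      rw [e, zero_mul, zero_mul, add_zero]
      nlinarith
    refine radialGrowth_of_segment_on hg hg' h0 (fun s hs => ?_) ht0 ht1
    obtain ⟨hc0, hc1, hc2⟩ := hargs' s hs
    have h0' := hfloor _ hc0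
    have h1' := hfloor _ hc1
    have h2' := hfloor _ hc2
    have hn : ‖v‖ ^ 2 ≤ v 0 ^ 2 + v 1 ^ 2 := by
      have hle : ‖v‖ ≤ Real.sqrt (v 0 ^ 2 + v 1 ^ 2) := by
        refine (pi_norm_le_iff_of_nonneg (Real.sqrt_nonneg _)).2 fun i => ?_
        rw [Real.norm_eq_abs, ← Real.sqrt_sq_eq_abs]
        apply Real.sqrt_le_sqrt
        fin_cases i <;> simp <;> nlinarith [sq_nonneg (v 0), sq_nonneg (v 1)]
      calc ‖v‖ ^ 2 ≤ Real.sqrt (v 0 ^ 2 + v 1 ^ 2) ^ 2 := pow_le_pow_left₀ (norm_nonneg _) hle 2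
        _ = v 0 ^ 2 + v 1 ^ 2 := Real.sq_sqrt (by positivity)
    have hsq : 0 ≤ (0 - v 0 - v 1) * (0 - v 0 - v 1) := mul_self_nonneg _
    nlinarith [mul_nonneg (sub_nonneg.2 hcA) hsq, h0', h1', h2', sq_nonneg (v 0), sq_nonneg (v 1),
      mul_le_mul_of_nonneg_right h0' (sq_nonneg (v 0)), mul_le_mul_of_nonneg_right h1' (sq_nonneg (v 1)),
      mul_le_mul_of_nonneg_right h2' hsq]
  have hup : ∀ x ∈ D', F x - F xs ≤ 6 * A / 2 * ‖x - xs‖ ^ 2 := by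
    intro x hx
    set v := x - xs with hv
    have hfun : (fun s : ℝ => F (AffineMap.homothety xs s x)) =
        fun s => f (τ / 3 + s * v 0) + f (τ / 3 + s * v 1) + f (τ - (τ / 3 + s * v 0) - (τ / 3 + s * v 1)) := by
      funext s
      rw [homothety_eq_add_smul, hline]
    have hargs' : ∀ s ∈ Icc (0 : ℝ) 1, τ / 3 + s * v 0 ∈ I ∧ τ / 3 + s * v 1 ∈ I ∧ τ - (τ / 3 + s * v 0) - (τ / 3 + s * v 1) ∈ I := by
      intro s hs
      have := hargs x hx xs hxsD' s hs
      simpa [hv, hxs] using this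
    have hg : ∀ s ∈ Icc (0 : ℝ) 1, HasDerivAt (fun s : ℝ => F (AffineMap.homothety xs s x))
        (f' (τ / 3 + s * v 0) * v 0 + f' (τ / 3 + s * v 1) * v 1 + f' (τ - (τ / 3 + s * v 0) - (τ / 3 + s * v 1)) * (0 - v 0 - v 1)) s := by
      intro s hs; rw [hfun]
      obtain ⟨h0I, h1I, h2I⟩ := hargs' s hs
      exact hasDerivAt_tripleSum_line_of_mem hf τ (τ / 3) (τ / 3) (v 0) (v 1) s h0I h1I h2I
    have hg' : ∀ s ∈ Icc (0 : ℝ) 1, HasDerivAt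
        (fun s : ℝ => f' (τ / 3 + s * v 0) * v 0 + f' (τ / 3 + s * v 1) * v 1 + f' (τ - (τ / 3 + s * v 0) - (τ / 3 + s * v 1)) * (0 - v 0 - v 1))
        (f'' (τ / 3 + s * v 0) * v 0 * v 0 + f'' (τ / 3 + s * v 1) * v 1 * v 1 +
          f'' (τ - (τ / 3 + s * v 0) - (τ / 3 + s * v 1)) * (0 - v 0 - v 1) * (0 - v 0 - v 1)) s := by
      intro s hs
      obtain ⟨h0I, h1I, h2I⟩ := hargs' s hs
      exact hasDerivAt_tripleSum_line_deriv_of_mem hf' τ (τ / 3) (τ / 3) (v 0) (v 1) s h0I h1I h2I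
    have h0 : f' (τ / 3 + 0 * v 0) * v 0 + f' (τ / 3 + 0 * v 1) * v 1 +
        f' (τ - (τ / 3 + 0 * v 0) - (τ / 3 + 0 * v 1)) * (0 - v 0 - v 1) ≤ 0 := by
      have e : τ - (τ / 3 + 0 * v 0) - (τ / 3 + 0 * v 1) = τ / 3 := by ring
      rw [e, zero_mul, zero_mul, add_zero]
      nlinarith
    refine radialUpper_of_segment_on hg hg' h0 (fun s hs => ?_)
    obtain ⟨hc0, hc1, hc2⟩ := hargs' s hs
    have h0' := hceil _ hc0
    have h1' := hceil _ hc1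
    have h2' := hceil _ hc2
    have hv0 := sq_apply_le_norm_sq v 0
    have hv1 := sq_apply_le_norm_sq v 1
    have hsq : (0 - v 0 - v 1) * (0 - v 0 - v 1) ≤ 2 * (v 0 ^ 2 + v 1 ^ 2) := by nlinarith [sq_nonneg (v 0 - v 1)]
    have hsq0 : 0 ≤ (0 - v 0 - v 1) * (0 - v 0 - v 1) := mul_self_nonneg _
    nlinarith [mul_le_mul_of_nonneg_right h0' (sq_nonneg (v 0)), mul_le_mul_of_nonneg_right h1' (sq_nonneg (v 1)),
      mul_le_mul_of_nonneg_right h2' hsq0, mul_le_mul_of_nonneg_left hsq hA.le]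
  -- measurability of `F`
  have hFm : Measurable F := by
    have h0m : Measurable fun p : Fin 2 → ℝ => p 0 := measurable_pi_apply 0
    have h1m : Measurable fun p : Fin 2 → ℝ => p 1 := measurable_pi_apply 1
    exact ((hfm.comp h0m).add (hfm.comp h1m)).add (hfm.comp ((measurable_const.sub h0m).sub h1m))
  -- the geometric inclusions
  have hDD' : D ⊆ D' := Metric.closedBall_subset_closedBall (by linarith)
  have hthick : Metric.thickening (h / 2) D ⊆ D' := by
    intro x hx
    obtain ⟨z, hz, hxz⟩ := Metric.mem_thickening_iff.1 hx
    rw [hD, mem_closedBall] at hz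
    rw [hD', mem_closedBall]
    linarith [dist_triangle x z xs]
  -- apply part 2 in dimension 2
  have hmain := card_mul_pow_le_of_levelWindow (ι := Fin 2) hDD' hh hthick hD'c measurableSet_closedBall hFm hxsD'
    hc (by linarith : c ≤ 6 * A) hρ'0.le (by positivity : (0 : ℝ) ≤ 4 * B) (subset_refl _) (by simp) hLip hgrow hup β δ hδ P hsep
    (fun p hp => ⟨(hP p hp).1, by simpa [hFdef] using (hP p hp).2⟩)
  simp only [Fintype.card_fin] at hmain
  -- simplify the dimension-2 bound
  have hδ'0 : 0 ≤ 2 * δ + (4 * B + 1) * h := by positivity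
  have e1 : (2 * Real.sqrt (12 * (2 : ℕ) * (6 * A) * (2 * δ + (4 * B + 1) * h)) / c) ^ 2 =
      4 * (12 * 2 * (6 * A) * (2 * δ + (4 * B + 1) * h)) / c ^ 2 := by
    rw [div_pow, mul_pow, Real.sq_sqrt (by positivity)]
    push_cast; ring
  have e2 : (2 * Real.sqrt (2 / c)) ^ 2 = 4 * (2 / c) := by
    rw [mul_pow, Real.sq_sqrt (by positivity)]; ring
  rw [e1, e2] at hmain
  simp only [Nat.cast_ofNat, Nat.sub_self, pow_zero, mul_one] at hmain
  have e3 : 4 * (12 * 2 * (6 * A) * (2 * δ + (4 * B + 1) * h)) / c ^ 2 + 4 * 2 * (6 * A) * (2 * δ + (4 * B + 1) * h) / c * (4 * (2 / c)) =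
      960 * A * (2 * δ + (4 * B + 1) * h) / c ^ 2 := by
    field_simp; ring
  linarith [hmain, e3.le, e3.ge]

end Summit.HubbardSuperconductivity.HubbardSuperconductivity.Theorems.ThinLevelSet

end
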